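import Mathlib.Analysis.Complex.RemovableSingularity
import Mathlib.Analysis.Complex.CauchyIntegral
import Mathlib.Analysis.Analytic.IsolatedZeros
import Mathlib.Analysis.Calculus.Deriv.Inv
import Mathlib.Analysis.Normed.Field.Lemmas
import Mathlib.Analysis.Asymptotics.Lemmas
import Mathlib.Topology.MetricSpace.Bounded

/-!
# Cauchy-type decay at infinity for holomorphic functions vanishing at infinity

Crux `WitnessCharge` (statement item `stmt-SmoothPoincare4-7824`), line `Sketch`,
stub `helper_decayAtInfinity`.

A function `g : ℂ → ℂ` which is holomorphic on an exterior region `{ξ | r < ‖ξ‖}` and tends to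
`0` at infinity satisfies `‖g ξ‖ ≤ C / ‖ξ‖` and `‖deriv g ξ‖ ≤ C / ‖ξ‖ ^ 2` for `‖ξ‖` large.

The proof is the **removable singularity theorem at infinity**: the function
`G := Function.update (fun t ↦ g t⁻¹) 0 0` is complex differentiable on a punctured
neighbourhood of `0` (chain rule with `t ↦ t⁻¹`) and continuous at `0` (because `t⁻¹ → ∞` as
`t → 0`, `t ≠ 0`), hence analytic at `0` by
`Complex.analyticAt_of_differentiable_on_punctured_nhds_of_continuousAt`. Since `G 0 = 0`,
differentiability at `0` gives `‖G t‖ ≤ c ‖t‖` near `0`, and continuity of the analytic function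
`deriv G` gives `‖deriv G t‖ ≤ c'` near `0`. Transporting back with `ξ = t⁻¹` and the chain rule
`deriv g ξ = deriv G ξ⁻¹ * (-(ξ ^ 2)⁻¹)` yields the two estimates.

## Main results

* `helper_decayAtInfinity_analyticAt_update_inv`: analyticity of `G` at `0`.
* `helper_decayAtInfinity_of_analyticAt`: the decay estimates for `g` from analyticity of `G`.
* `helper_decayAtInfinity`: the registered stub.
-/

noncomputable section

set_option linter.dupNamespace false

open Set Filter Topology Metric

namespace Summit.SmoothPoincare4.SmoothPoincare4.Theorems.WitnessCharge.PencilIncompleteness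

/-- **Removable singularity at infinity.** If `g` is holomorphic on the exterior region
`{ξ | r < ‖ξ‖}` and tends to `0` along the cocompact filter, then the function
`t ↦ g t⁻¹`, extended by the value `0` at `t = 0`, is analytic at `0`. -/
theorem helper_decayAtInfinity_analyticAt_update_inv {g : ℂ → ℂ} {r : ℝ}
    (hg : DifferentiableOn ℂ g {ξ : ℂ | r < ‖ξ‖}) (hlim : Tendsto g (cocompact ℂ) (𝓝 0)) :
    AnalyticAt ℂ (Function.update (fun t : ℂ => g t⁻¹) 0 0) 0 := by
  refine Complex.analyticAt_of_differentiable_on_punctured_nhds_of_continuousAt ?_ ?_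
  · -- complex differentiability on a punctured neighbourhood of `0`
    have hr0 : 0 < max r 0 + 1 := by positivity
    rw [eventually_nhdsWithin_iff]
    filter_upwards [Metric.ball_mem_nhds (0 : ℂ) (inv_pos.mpr hr0)] with t ht ht0
    replace ht0 : t ≠ 0 := mem_compl_singleton_iff.mp ht0
    have htn : 0 < ‖t‖ := norm_pos_iff.mpr ht0
    rw [mem_ball_zero_iff] at ht
    have hlt : r < ‖t⁻¹‖ := by
      rw [norm_inv]
      have h1 : max r 0 + 1 < ‖t‖⁻¹ := by rwa [lt_inv_comm₀ hr0 htn]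
      linarith [le_max_left r 0]
    have hgt : DifferentiableAt ℂ g t⁻¹ :=
      hg.differentiableAt ((isOpen_lt continuous_const continuous_norm).mem_nhds hlt)
    have hcomp : DifferentiableAt ℂ (fun s : ℂ => g s⁻¹) t :=
      hgt.comp t (differentiableAt_inv_iff.mpr ht0)
    refine hcomp.congr_of_eventuallyEq ?_
    filter_upwards [eventually_ne_nhds ht0] with s hs
    exact Function.update_of_ne hs _ _
  · -- continuity at `0`: `g t⁻¹ → 0` as `t → 0`, `t ≠ 0`
    rw [continuousAt_update_same]
    have h1 : Tendsto (Inv.inv : ℂ → ℂ) (𝓝[≠] 0) (cocompact ℂ) := by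
      rw [← Metric.cobounded_eq_cocompact]
      exact Filter.tendsto_inv₀_nhdsNE_zero
    exact hlim.comp h1

/-- **Decay estimates from the removable singularity at infinity.** If `G` is analytic at `0`
with `G 0 = 0` and `G t = g t⁻¹` for `t ≠ 0`, then there are `c` and `δ > 0` such that
`‖g ξ‖ ≤ c / ‖ξ‖` and `‖deriv g ξ‖ ≤ c / ‖ξ‖ ^ 2` whenever `ξ ≠ 0` and `‖ξ⁻¹‖ ≤ δ`. The first bound
is differentiability of `G` at `0`, the second is continuity of `deriv G` at `0` together with the
chain rule for `g = G ∘ (·)⁻¹` near `ξ`. -/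
theorem helper_decayAtInfinity_of_analyticAt {G g : ℂ → ℂ} (hA : AnalyticAt ℂ G 0)
    (hG0 : G 0 = 0) (heq : ∀ t : ℂ, t ≠ 0 → G t = g t⁻¹) :
    ∃ c δ : ℝ, 0 < δ ∧ ∀ ξ : ℂ, ξ ≠ 0 → ‖ξ⁻¹‖ ≤ δ →
      ‖g ξ‖ ≤ c / ‖ξ‖ ∧ ‖deriv g ξ‖ ≤ c / ‖ξ‖ ^ 2 := by
  -- linear bound on `G` near `0` (from the derivative at `0`, using `G 0 = 0`)
  obtain ⟨c, hc⟩ := hA.differentiableAt.hasDerivAt.isBigO_sub.bound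
  -- bound on `deriv G` near `0` (continuity of the analytic function `deriv G`)
  obtain ⟨c', hc'⟩ := (hA.deriv.continuousAt.tendsto.isBigO_one ℝ).bound
  -- collect everything on a closed ball around `0`
  obtain ⟨δ, hδ, hball⟩ := Metric.nhds_basis_closedBall.eventually_iff.mp
    (hA.eventually_analyticAt.and (hc.and hc'))
  refine ⟨max c c', δ, hδ, fun ξ hξ0 hξδ => ?_⟩
  obtain ⟨h1, h2, h3⟩ := hball (mem_closedBall_zero_iff.mpr hξδ)
  rw [hG0, sub_zero, sub_zero, heq _ (inv_ne_zero hξ0), inv_inv] at h2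
  rw [norm_one, mul_one] at h3
  -- the chain rule for `g = G ∘ (·)⁻¹` near `ξ`
  have hder : HasDerivAt g (deriv G ξ⁻¹ * -(ξ ^ 2)⁻¹) ξ := by
    refine (h1.differentiableAt.hasDerivAt.comp ξ (hasDerivAt_inv hξ0)).congr_of_eventuallyEq ?_
    filter_upwards [eventually_ne_nhds hξ0] with ζ hζ
    simp only [Function.comp_apply, heq _ (inv_ne_zero hζ), inv_inv]
  have hξpos : 0 < ‖ξ‖ := norm_pos_iff.mpr hξ0
  constructor
  · calc ‖g ξ‖ ≤ c * ‖ξ⁻¹‖ := h2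
      _ ≤ max c c' * ‖ξ⁻¹‖ := mul_le_mul_of_nonneg_right (le_max_left _ _) (norm_nonneg _)
      _ = max c c' / ‖ξ‖ := by rw [norm_inv, div_eq_mul_inv]
  · rw [hder.deriv, norm_mul, norm_neg, norm_inv, norm_pow]
    calc ‖deriv G ξ⁻¹‖ * (‖ξ‖ ^ 2)⁻¹ ≤ max c c' * (‖ξ‖ ^ 2)⁻¹ :=
          mul_le_mul_of_nonneg_right (h3.trans (le_max_right _ _))
            (inv_nonneg.mpr (pow_nonneg hξpos.le 2))
      _ = max c c' / ‖ξ‖ ^ 2 := (div_eq_mul_inv _ _).symm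

/-- **Cauchy-type decay at infinity.** Let `g : ℂ → ℂ` be holomorphic on the exterior region
`{ξ | r < ‖ξ‖}` and tend to `0` at infinity (along the cocompact filter of `ℂ`). Then there are a
constant `C` and a radius `r₁ > 0` with `r ≤ r₁` such that for all `ξ` with `r₁ ≤ ‖ξ‖` one has
`‖g ξ‖ ≤ C / ‖ξ‖` and `‖deriv g ξ‖ ≤ C / ‖ξ‖ ^ 2`. This is the removable singularity theorem at
infinity (`G t := g t⁻¹` extends analytically by `0` across `t = 0`) combined with the chain rule
for `t ↦ t⁻¹`; it is used in the canonical parametrisation of pencil members, whose flat coordinate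
`Z` satisfies `Z ξ - ξ → 0` at infinity. -/
theorem helper_decayAtInfinity :
    ∀ (g : ℂ → ℂ) (r : ℝ), DifferentiableOn ℂ g {ξ : ℂ | r < ‖ξ‖} →
      Tendsto g (cocompact ℂ) (𝓝 0) →
      ∃ C r₁ : ℝ, 0 < r₁ ∧ r ≤ r₁ ∧
        ∀ ξ : ℂ, r₁ ≤ ‖ξ‖ → ‖g ξ‖ ≤ C / ‖ξ‖ ∧ ‖deriv g ξ‖ ≤ C / ‖ξ‖ ^ 2 := by
  intro g r hg hlim
  obtain ⟨c, δ, hδ, hdec⟩ := helper_decayAtInfinity_of_analyticAt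
    (helper_decayAtInfinity_analyticAt_update_inv hg hlim) (Function.update_self _ _ _)
    (fun t ht => Function.update_of_ne ht _ _)
  have hpos : (0 : ℝ) < max (max r 1) δ⁻¹ := lt_max_of_lt_left (lt_max_of_lt_right one_pos)
  refine ⟨c, max (max r 1) δ⁻¹, hpos, (le_max_left r 1).trans (le_max_left _ _), fun ξ hξ => ?_⟩
  have hξpos : 0 < ‖ξ‖ := hpos.trans_le hξ
  refine hdec ξ (norm_pos_iff.mp hξpos) ?_
  rw [norm_inv]
  exact inv_le_of_inv_le₀ hδ ((le_max_right _ _).trans hξ)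

end Summit.SmoothPoincare4.SmoothPoincare4.Theorems.WitnessCharge.PencilIncompleteness
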